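import Mathlib
import Summits.CriticalPhenomena.CardyFormulaZ2.Theorems.CardyMagicRigidityNestingRigidityTowerMomentUpperFamilies
import Summits.CriticalPhenomena.CardyFormulaZ2.Theorems.CardyMagicRigidityNestingRigidityFusionCloudCarriers
import HarnessLib

/-!
# Crux `NestingRigidity`, line `positive-cone-weight-doubling`: cells on a circle, loops crossing a
# thin collar, and their sorting into the cells (collar statistic, helper K
# `uvCollar_expMoment_latticeEnsembles`)

Crux `Summit.CriticalPhenomena.CardyFormulaZ2.Theses.CardyMagicRigidity.NestingRigidity`
(stmt-CriticalPhenomena-4835), line `positive-cone-weight-doubling`, registered helper K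
`uvCollar_expMoment_latticeEnsembles` (all-order exponential moments of the collar statistic
`K = Σ_{u ∈ C_r} φ_u + #X + Σ_{u ∈ C_1} ψ_u` of the cone cloud).  All three pieces of `K` count loops
that CROSS A THIN COLLAR `{ρ₁ ≤ |z| ≤ ρ₂}` (`ρ₂ − ρ₁ ≤ 2δ`): the inner-collar crossers (radius `r`),
the exit loops and the outer-collar crossers (radius `1`); the staircase of line
`ring-cloud-tomography` has the same collars at the radii of its rings.  This file is the
deterministic geometry of ONE scale of such a count at a GENERAL radius (no probability, no cited
fact, no definition):

* `UVCollar.exists_mem_range_norm_mem_Icc`: a loop meeting `B̄(0, ρ₂)` and leaving `B(0, ρ₁)`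
  (`ρ₁ ≤ ρ₂`) passes through the closed collar `ρ₁ ≤ |z| ≤ ρ₂` (the trace is connected:
  `FusionCloud.isPreconnected_range` of `…FusionCloudCarriers`);
* `UVCollar.exists_circle_cells`: for `ρ, a > 0` there are `B ≤ 4πρ/a + 3` centres `c i` ON the
  circle `|z| = ρ` such that every point of the circle is within `a/2` of a centre (polar grid);
  hence (`UVCollar.exists_cell_of_collar`) every point `z` of the collar `ρ − a/2 ≤ |z| ≤ ρ` is
  within `a` of a centre;
* `UVCollar.exists_families_of_cells`: a finite family `S` (`#S ≤ M`) of loops, each meeting the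
  inner ball `B̄(c i, a i)` and leaving the outer ball `B(c i, b i)` of SOME cell, is sorted into
  pairwise disjoint sub-families `T i ⊆ S`, one per cell, with multiplicities `m i = #T i ∈ Fin (M+1)`
  summing to `#S` (`TowerMomentUpper.exists_sorting`) — the input of the joint disjoint-occurrence
  lemmas `BigLoopsExp.mem_foldr_*_families` of `…BigLoopsExpMomentBK(T)`;
* registered anchor `uvCollar_families_of_cells` (the sorting, in registered form).
-/

noncomputable section

open Set Metric
open scoped Real BigOperators

namespace Summit.CriticalPhenomena.CardyFormulaZ2.Cruxes.NestingRigidity.PositiveConeWeightDoubling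

open Literature.Probability.RandomPlanarGeometry
open Summit.CriticalPhenomena.CardyFormulaZ2.Cruxes.NestingRigidity.RingCloudTomography

namespace UVCollar

/-! ## Loops crossing a thin collar pass through it -/

/-- **A loop meeting `B̄(0, ρ₂)` and leaving `B(0, ρ₁)` passes through the collar
`ρ₁ ≤ |z| ≤ ρ₂`** (`ρ₁ ≤ ρ₂`; intermediate value theorem on the connected trace). -/
theorem exists_mem_range_norm_mem_Icc (u : UnbasedLoop ℂ) {ρ₁ ρ₂ : ℝ} (h12 : ρ₁ ≤ ρ₂)
    (hmeet : (u.range ∩ closedBall (0 : ℂ) ρ₂).Nonempty) (hout : ¬ u.range ⊆ ball (0 : ℂ) ρ₁) :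
    ∃ z ∈ u.range, ρ₁ ≤ ‖z‖ ∧ ‖z‖ ≤ ρ₂ := by
  obtain ⟨p, hp, hpρ⟩ := hmeet
  rw [mem_closedBall, dist_zero_right] at hpρ
  obtain ⟨q, hq, hqρ⟩ := not_subset.1 hout
  rw [mem_ball, dist_zero_right, not_lt] at hqρ
  by_cases hp1 : ρ₁ ≤ ‖p‖
  · exact ⟨p, hp, hp1, hpρ⟩
  · have hIVT := (FusionCloud.isPreconnected_range u).intermediate_value hp hq continuous_norm.continuousOn
    obtain ⟨z, hz, hzρ⟩ := hIVT ⟨(not_le.1 hp1).le, hqρ⟩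
    exact ⟨z, hz, hzρ.ge, hzρ.le.trans h12⟩

/-! ## Cells on a circle -/

/-- Two points of the circle of radius `ρ ≥ 0` at angles `θ`, `θ'` are at distance
`≤ ρ |θ − θ'|`. -/
theorem norm_circle_sub_le {ρ : ℝ} (hρ : 0 ≤ ρ) (θ θ' : ℝ) :
    ‖(ρ : ℂ) * Complex.exp (Complex.I * θ) - (ρ : ℂ) * Complex.exp (Complex.I * θ')‖ ≤ ρ * |θ - θ'| := by
  have e : (ρ : ℂ) * Complex.exp (Complex.I * θ) - (ρ : ℂ) * Complex.exp (Complex.I * θ') =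
      (ρ : ℂ) * Complex.exp (Complex.I * θ') * (Complex.exp (Complex.I * ((θ - θ' : ℝ) : ℂ)) - 1) := by
    rw [mul_sub, mul_one, mul_assoc, ← Complex.exp_add]
    push_cast
    ring_nf
  rw [e, norm_mul, norm_mul, Complex.norm_real, Real.norm_of_nonneg hρ, Complex.norm_exp_I_mul_ofReal,
    mul_one]
  refine mul_le_mul_of_nonneg_left ?_ hρ
  have := Real.norm_exp_I_mul_ofReal_sub_one_le (x := θ - θ')
  rwa [Real.norm_eq_abs] at this

/-- **Cells on a circle.**  For `ρ > 0` and a spacing `a > 0` there are `B ≤ 4πρ/a + 3` centres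
`c i` on the circle `|z| = ρ` such that every point of the circle is within `a/2` of a centre (the
polar grid of `2n + 1` angles `2πk/n`, `|k| ≤ n`, `n = ⌈2πρ/a⌉`). -/
theorem exists_circle_cells {ρ a : ℝ} (hρ : 0 < ρ) (ha : 0 < a) :
    ∃ (B : ℕ) (c : Fin B → ℂ), (B : ℝ) ≤ 4 * π * ρ / a + 3 ∧ (∀ i, ‖c i‖ = ρ) ∧
      ∀ w : ℂ, ‖w‖ = ρ → ∃ i, dist w (c i) ≤ a / 2 := by
  set n : ℕ := ⌈2 * π * ρ / a⌉₊ with hn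
  have hn0 : 0 < n := Nat.ceil_pos.2 (by positivity)
  have hn0' : (0 : ℝ) < n := by exact_mod_cast hn0
  have hnle : (n : ℝ) ≤ 2 * π * ρ / a + 1 := (Nat.ceil_lt_add_one (by positivity)).le
  have hnge : 2 * π * ρ / a ≤ n := Nat.le_ceil _
  set h : ℝ := 2 * π / n with hh
  have hhpos : 0 < h := by positivity
  refine ⟨2 * n + 1, fun j ↦ (ρ : ℂ) * Complex.exp (Complex.I * ((h * (((j : ℕ) : ℤ) - n : ℤ) : ℝ) : ℂ)),
    ?_, fun j ↦ ?_, fun w hw ↦ ?_⟩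
  · have e : 4 * π * ρ / a = 2 * (2 * π * ρ / a) := by ring
    push_cast; rw [e]; linarith
  · rw [norm_mul, Complex.norm_real, Real.norm_of_nonneg hρ.le, Complex.norm_exp_I_mul_ofReal, mul_one]
  · -- the angle of `w` and its grid index
    set θ : ℝ := Complex.arg w with hθ
    have hw' : w = (ρ : ℂ) * Complex.exp (Complex.I * θ) := by
      rw [← hw, mul_comm Complex.I, Complex.norm_mul_exp_arg_mul_I]
    set k : ℤ := round (θ / h) with hk
    have hkn : |k| ≤ (n : ℤ) := by
      refine TowerMomentUpper.abs_round_div_le hhpos ?_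
      rw [hh, mul_div_cancel₀ _ hn0'.ne']
      have := Complex.abs_arg_le_pi w
      rw [← hθ] at this
      linarith [Real.pi_pos]
    have hk1 := (abs_le.1 hkn).1
    have hk2 := (abs_le.1 hkn).2
    refine ⟨⟨(k + n).toNat, by omega⟩, ?_⟩
    have e1 : ((((k + n).toNat : ℕ) : ℤ) - n : ℤ) = k := by rw [Int.toNat_of_nonneg (by omega)]; ring
    dsimp only
    rw [e1, hw', dist_eq_norm]
    refine (norm_circle_sub_le hρ.le θ _).trans ?_
    have h1 := TowerMomentUpper.abs_sub_mul_round_le hhpos θ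
    rw [← hk] at h1
    have h2 : ρ * (h / 2) ≤ a / 2 := by
      have e2 : ρ * (h / 2) = (2 * π * ρ / a) * a / (2 * n) := by
        rw [hh]; field_simp
      rw [e2, div_le_div_iff₀ (by positivity) two_pos]
      nlinarith [mul_le_mul_of_nonneg_right hnge ha.le]
    calc ρ * |θ - h * k| ≤ ρ * (h / 2) := mul_le_mul_of_nonneg_left h1 hρ.le
      _ ≤ a / 2 := h2

/-- **Points of a thin collar are close to the cells**: with the cells of `exists_circle_cells` at
radius `ρ` and spacing `a`, every `z` with `ρ − a/2 ≤ |z| ≤ ρ` is within `a` of a centre (its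
radial projection is within `a/2` of a centre and within `a/2` of `z`). -/
theorem exists_cell_of_collar {ρ a : ℝ} (hρ : 0 < ρ) {B : ℕ} {c : Fin B → ℂ}
    (hc : ∀ w : ℂ, ‖w‖ = ρ → ∃ i, dist w (c i) ≤ a / 2) {z : ℂ} (hz1 : ρ - a / 2 ≤ ‖z‖)
    (hz2 : ‖z‖ ≤ ρ) : ∃ i, dist z (c i) ≤ a := by
  by_cases hz0 : z = 0
  · subst hz0
    obtain ⟨i, hi⟩ := hc (ρ : ℂ) (by rw [Complex.norm_real, Real.norm_of_nonneg hρ.le])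
    refine ⟨i, ?_⟩
    rw [norm_zero] at hz1
    calc dist 0 (c i) ≤ dist (0 : ℂ) ρ + dist (ρ : ℂ) (c i) := dist_triangle _ _ _
      _ ≤ ρ + a / 2 := by rw [dist_zero_left, Complex.norm_real, Real.norm_of_nonneg hρ.le]; linarith
      _ ≤ a := by linarith
  have hzn : 0 < ‖z‖ := norm_pos_iff.2 hz0
  -- the radial projection
  set w : ℂ := ((ρ / ‖z‖ : ℝ) : ℂ) * z with hw
  have hwn : ‖w‖ = ρ := by
    rw [hw, norm_mul, Complex.norm_real, Real.norm_of_nonneg (by positivity), div_mul_cancel₀ _ hzn.ne']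
  have hzw : dist z w ≤ a / 2 := by
    rw [dist_eq_norm, hw]
    have e : z - ((ρ / ‖z‖ : ℝ) : ℂ) * z = ((1 - ρ / ‖z‖ : ℝ) : ℂ) * z := by push_cast; ring
    rw [e, norm_mul, Complex.norm_real, Real.norm_eq_abs]
    have e2 : |1 - ρ / ‖z‖| * ‖z‖ = |‖z‖ - ρ| := by
      rw [← abs_of_pos hzn, ← abs_mul, abs_of_pos hzn, sub_mul, one_mul, div_mul_cancel₀ _ hzn.ne']
    rw [e2, abs_sub_comm, abs_of_nonneg (by linarith)]
    linarith
  obtain ⟨i, hi⟩ := hc w hwn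
  exact ⟨i, (dist_triangle z w (c i)).trans (by linarith)⟩

/-! ## Sorting a finite family of loops into the cells -/

/-- **Sorting into cells.**  A finite family `S` of at most `M` loops, each of which meets the inner
ball `B̄(c i, a i)` and leaves the outer ball `B(c i, b i)` of some cell `i`, splits into pairwise
disjoint finite sub-families `T i ⊆ S`, every loop of `T i` meeting `B̄(c i, a i)` and
`ℂ ∖ B(c i, b i)`, with multiplicities `m i = #T i ∈ Fin (M + 1)` summing to `#S`. -/
theorem exists_families_of_cells {S : Set (UnbasedLoop ℂ)} (hS : S.Finite) {M : ℕ}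
    (hSM : S.ncard ≤ M) {B : ℕ} (c : Fin B → ℂ) (a b : Fin B → ℝ)
    (hcell : ∀ u ∈ S, ∃ i, (u.range ∩ closedBall (c i) (a i)).Nonempty ∧
      (u.range ∩ (ball (c i) (b i))ᶜ).Nonempty) :
    ∃ (T : Fin B → Set (UnbasedLoop ℂ)) (m : Fin B → Fin (M + 1)), (∀ i, T i ⊆ S) ∧
      (∀ i, (T i).Finite) ∧ (Pairwise fun i i' ↦ Disjoint (T i) (T i')) ∧
      (∀ i, ∀ u ∈ T i, (u.range ∩ closedBall (c i) (a i)).Nonempty ∧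
        (u.range ∩ (ball (c i) (b i))ᶜ).Nonempty) ∧
      (∀ i, (m i : ℕ) = (T i).ncard) ∧ ∑ i, (m i : ℕ) = S.ncard := by
  classical
  rcases isEmpty_or_nonempty (Fin B) with hB | hB
  · -- no cell: `S` is empty
    have hS0 : S = ∅ := by
      by_contra hne
      obtain ⟨u, hu⟩ := nonempty_iff_ne_empty.2 hne
      obtain ⟨i, -⟩ := hcell u hu
      exact isEmptyElim i
    refine ⟨fun i ↦ isEmptyElim i, fun i ↦ isEmptyElim i, fun i ↦ isEmptyElim i,
      fun i ↦ isEmptyElim i, fun i ↦ isEmptyElim i, fun i ↦ isEmptyElim i, fun i ↦ isEmptyElim i, ?_⟩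
    rw [hS0, ncard_empty, Finset.univ_eq_empty, Finset.sum_empty]
  · obtain ⟨i₁⟩ := hB
    set good : UnbasedLoop ℂ → Fin B → Prop := fun u i ↦
      (u.range ∩ closedBall (c i) (a i)).Nonempty ∧ (u.range ∩ (ball (c i) (b i))ᶜ).Nonempty with hgood
    set cell : UnbasedLoop ℂ → Fin B := fun u ↦ if h : ∃ i, good u i then h.choose else i₁ with hcell'
    have hcellS : ∀ u ∈ S, good u (cell u) := by
      intro u hu
      have hex : ∃ i, good u i := hcell u hu
      simp only [hcell', dif_pos hex]
      exact hex.choose_spec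
    obtain ⟨T, m, hTS, hTfin, hTdisj, hTcell, hm, hsum⟩ := TowerMomentUpper.exists_sorting hS hSM cell
    refine ⟨T, m, hTS, hTfin, hTdisj, fun i u hu ↦ ?_, hm, hsum⟩
    have hg := hcellS u (hTS i hu)
    rw [hTcell i u hu] at hg
    exact hg

end UVCollar

/-! ## Anchor: the sorting in registered form -/

/-- **Anchor (helper toward K `uvCollar_expMoment_latticeEnsembles`): sorting collar loops into
cells** — a finite family `S` (`#S ≤ M`) of loops each meeting the inner ball and leaving the outer
ball of some cell splits into pairwise disjoint per-cell sub-families with multiplicities in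
`Fin (M+1)` summing to `#S` (`UVCollar.exists_families_of_cells`). -/
theorem uvCollar_families_of_cells : ∀ (S : Set (UnbasedLoop ℂ)) (M B : ℕ) (c : Fin B → ℂ) (a b : Fin B → ℝ), S.Finite → S.ncard ≤ M → (∀ u ∈ S, ∃ i, (u.range ∩ Metric.closedBall (c i) (a i)).Nonempty ∧ (u.range ∩ (Metric.ball (c i) (b i))ᶜ).Nonempty) → ∃ (T : Fin B → Set (UnbasedLoop ℂ)) (m : Fin B → Fin (M + 1)), (∀ i, T i ⊆ S) ∧ (∀ i, (T i).Finite) ∧ (Pairwise fun i i' ↦ Disjoint (T i) (T i')) ∧ (∀ i, ∀ u ∈ T i, (u.range ∩ Metric.closedBall (c i) (a i)).Nonempty ∧ (u.range ∩ (Metric.ball (c i) (b i))ᶜ).Nonempty) ∧ (∀ i, (m i : ℕ) = (T i).ncard) ∧ ∑ i, (m i : ℕ) = S.ncard := by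
  intro S M B c a b hS hSM hcell
  exact UVCollar.exists_families_of_cells hS hSM c a b hcell

end Summit.CriticalPhenomena.CardyFormulaZ2.Cruxes.NestingRigidity.PositiveConeWeightDoubling

end
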